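import Literature.MathematicalPhysics.QuantumLattice.GrassmannParity
import Literature.Probability.LatticeModels.CumulantExponentialClosedForm
import Mathlib.LinearAlgebra.CliffordAlgebra.Even
import HarnessLib

/-!
# Truncated expectations with spectator fields: the even part as the ring of values

Topic `Literature/MathematicalPhysics/QuantumLattice`.  In the multiscale integration of
Benfatto–Giuliani–Mastropietro 2006, §2.2–2.3 ((2.11)–(2.16), (2.29)–(2.31)) one integrates the
fields of one scale, `ψ^{(h)}`, the fields of the lower scales being *spectators*: the simple and
truncated expectations `𝓔_h(X)`, `𝓔ᵀ_h(X₁, …, X_s)` of even elements are again even elements of the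
Grassmann algebra of the remaining fields, and the effective potential on scale `h - 1` is defined
by `𝒱^{(h-1)} + const = Σₙ (1/n!) 𝓔ᵀ_h(𝒱^{(h)}; n)` ((2.31); Mastropietro 2008, (2.47)–(2.53)).  Since
even elements commute with everything (`GrassmannParity.lean`), the even part
`evenPart R J = ⋀^{even}` is a **commutative** ring, the block integration `gaussOn` maps it to itself,
and the whole moment–cumulant formalism (`Literature/Probability/LatticeModels/UrsellInversion`,
`CumulantExponentialClosedForm`) applies *with values in the even part*.  This file sets this up:

* `evenPart R J` (Mathlib's `CliffordAlgebra.even` for the zero form) with its `CommRing` structure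
  (the `ℚ`-algebra structure is Mathlib's `Subalgebra.algebra'`); `evenGaussOn R e A u` — the normalised block integration
  `X ↦ u · ∫dθ_block e^{ψ̄Aψ} X` as an `R`-linear endomorphism of the even part;
* `evenMoment`, `evenTruncated` — moments `𝓔(∏_{i∈P} Xᵢ)` and truncated expectations
  `𝓔ᵀ(Xᵢ : i ∈ P)` of a family of even elements, *even-part valued*; `evenMoment_empty`
  (normalisation), the cluster decomposition `sum_setPartitions_prod_evenTruncated`,
  `evenTruncated_singleton`;
* `evenMoment_spectator_mul`, `evenTruncated_spectator_mul` — **even spectator coefficients pull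
  out**: `𝓔ᵀ(a₁X₁, …; P) = (∏_{i∈P} aᵢ) 𝓔ᵀ(X₁, …; P)` for spectators `aᵢ` (Salmhofer's linearity over
  the spectator algebra, `gaussOn_spectator_mul`, and the scaling covariance of the Ursell function
  `ursellOf_mul_prod`);
* `evenMap`, `evenMoment_evenMap`, `evenTruncated_evenMap` — for families supported in the block
  the values are scalars (`ursellOf_ringHom`: naturality of the Ursell function);
* `egf_evenGaussOn_pow_eq_exp_subst` — **`𝓔(e^{tX}) = exp Σₙ tⁿ 𝓔ᵀ(X; n)/n!` with spectators**, as
  formal power series over the even part (BGM (2.13), (2.31)).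

Everything is proved; no named fact.

## Sources

G. Benfatto, A. Giuliani, V. Mastropietro, Ann. Henri Poincaré 7 (2006), §2.2–2.3 (2.11)–(2.16),
(2.29)–(2.31) (`BenfattoGiulianiMastropietro2006`); V. Mastropietro, *Non-Perturbative
Renormalization* (2008), §2.3–2.5 (2.32)–(2.53) (`Mastropietro2008`); M. Salmhofer,
*Renormalization* (1999), Remark B.8 (`Salmhofer1999`).
-/

noncomputable section

namespace Literature.MathematicalPhysics.QuantumLattice

open GrassmannAlgebra Finset PowerSeries Literature.Probability.LatticeModels

namespace GrassmannAlgebra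

variable (R : Type*) [CommRing R] (J : Type*)

/-- The **even part** `⋀^{even}` of the Grassmann algebra, as a subalgebra (Mathlib's
`CliffordAlgebra.even` for the zero quadratic form). [folklore] -/
abbrev evenPart : Subalgebra R (GrassmannAlgebra R J) :=
  CliffordAlgebra.even (0 : QuadraticForm R (J → R))

variable {R J}

/-- Membership in the even part is membership in the even submodule. [folklore] -/
theorem mem_evenPart_iff {x : GrassmannAlgebra R J} : x ∈ evenPart R J ↔ x ∈ evenOdd R 0 := Iff.rfl

variable (R J)

/-- **The even part is commutative** (even elements are central). [folklore] -/
instance instCommRingEvenPart : CommRing (evenPart R J) :=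
  { (inferInstance : Ring (evenPart R J)) with
    mul_comm := fun a b => Subtype.ext (commute_of_mem_evenOdd_zero R a.2 b.1).eq }

variable {R J}

/-- Coercion of a finite product in the (commutative) even part: it lies in every subalgebra
containing the factors. [folklore] -/
theorem coe_prod_mem {α : Type*} (S : Subalgebra R (GrassmannAlgebra R J)) (a : α → evenPart R J) (P : Finset α)
    (h : ∀ i ∈ P, (a i : GrassmannAlgebra R J) ∈ S) : ((∏ i ∈ P, a i : evenPart R J) : GrassmannAlgebra R J) ∈ S := by
  classical
  induction P using Finset.induction_on with
  | empty => rw [prod_empty, OneMemClass.coe_one]; exact one_mem S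
  | insert i P hi ih =>
    rw [prod_insert hi, MulMemClass.coe_mul]
    exact mul_mem (h i (mem_insert_self i P)) (ih fun j hj => h j (mem_insert_of_mem hj))

end GrassmannAlgebra

section Block

variable (R : Type*) [CommRing R] [Algebra ℚ R] {ι : Type*} [LinearOrder ι] [Fintype ι]
  {J : Type*} [LinearOrder J] [Fintype J]
variable (e : ι ⊕ₗ ι ↪o J) (A : Matrix ι ι R) (u : R)

/-- **The normalised Gaussian integration of a fermion block, on the even part**:
`X ↦ u · ∫dθ_{e(ι ⊕ₗ ι)} e^{ψ̄Aψ} X`, an `R`-linear endomorphism of the commutative ring `⋀^{even}`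
(`u` the inverse normalisation, `u · ε det A = 1`; the spectator fields are those outside the block).
[folklore] -/
def evenGaussOn : evenPart R J →ₗ[R] evenPart R J where
  toFun x := ⟨u • gaussOn R e A x, Submodule.smul_mem _ u (gaussOn_mem_evenOdd_zero R e A x.2)⟩
  map_add' x y := Subtype.ext (by simp [smul_add])
  map_smul' r x := Subtype.ext (by simp [smul_comm u r])

/-- Unfolding `evenGaussOn`. [folklore] -/
@[simp] theorem coe_evenGaussOn (x : evenPart R J) :
    (evenGaussOn R e A u x : GrassmannAlgebra R J) = u • gaussOn R e A x := rfl

/-- Normalisation: `𝓔(1) = 1` when `u · ε det A = 1`. [folklore] -/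
theorem evenGaussOn_one (hu : u * ((-1 : R) ^ (Fintype.card ι * (Fintype.card ι - 1) / 2) * A.det) = 1) :
    evenGaussOn R e A u 1 = 1 := by
  refine Subtype.ext ?_
  rw [coe_evenGaussOn, OneMemClass.coe_one, gaussOn_one, Algebra.smul_def, ← map_mul, hu, map_one]

/-- **Linearity over even spectators** (Salmhofer 1999, Remark B.8): `𝓔(a X) = a 𝓔(X)` for an even
`a` in the algebra of the fields outside the block. [folklore] -/
theorem evenGaussOn_spectator_mul {a : evenPart R J}
    (ha : (a : GrassmannAlgebra R J) ∈ spectatorSubalgebra R (Finset.univ.map e.toEmbedding)) (x : evenPart R J) :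
    evenGaussOn R e A u (a * x) = a * evenGaussOn R e A u x := by
  refine Subtype.ext ?_
  rw [coe_evenGaussOn, MulMemClass.coe_mul, MulMemClass.coe_mul, coe_evenGaussOn, gaussOn_spectator_mul R e A ha,
    mul_smul_comm]

/-! ### Moments and truncated expectations of a family of even elements -/

variable {α : Type*} [DecidableEq α]

/-- The **moments** `P ↦ 𝓔(∏_{i∈P} Xᵢ)` of a family of even elements, even-part valued. [folklore] -/
def evenMoment (y : α → evenPart R J) (P : Finset α) : evenPart R J :=
  evenGaussOn R e A u (∏ i ∈ P, y i)

/-- The **truncated expectations** `P ↦ 𝓔ᵀ(Xᵢ : i ∈ P)` of a family of even elements with the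
fields outside the block as spectators: the Ursell function of the even-part-valued moments
(Benfatto–Giuliani–Mastropietro 2006, (2.14)–(2.16); Mastropietro 2008, (2.32)–(2.38)). [folklore] -/
def evenTruncated (y : α → evenPart R J) : Finset α → evenPart R J :=
  ursellOf (evenMoment R e A u y)

variable (y : α → evenPart R J)

omit [DecidableEq α] in
/-- `𝓔(∏_∅) = 1`. [folklore] -/
theorem evenMoment_empty (hu : u * ((-1 : R) ^ (Fintype.card ι * (Fintype.card ι - 1) / 2) * A.det) = 1) :
    evenMoment R e A u y ∅ = 1 := by
  rw [evenMoment, prod_empty, evenGaussOn_one R e A u hu]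

/-- **Cluster decomposition with spectators**: `𝓔(∏_{i∈V} Xᵢ) = Σ_{π} ∏_{P∈π} 𝓔ᵀ(X; P)` for
nonempty `V`. [folklore] -/
theorem sum_setPartitions_prod_evenTruncated {V : Finset α} (hV : V.Nonempty) :
    ∑ π ∈ setPartitions V, ∏ P ∈ π, evenTruncated R e A u y P = evenMoment R e A u y V :=
  sum_setPartitions_prod_ursellOf _ hV

/-- `𝓔ᵀ(X; {v}) = 𝓔(X_v)`. [folklore] -/
theorem evenTruncated_singleton (v : α) : evenTruncated R e A u y {v} = evenGaussOn R e A u (y v) := by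
  rw [evenTruncated, ursellOf_singleton, evenMoment, prod_singleton]

/-! ### Even spectator coefficients pull out -/

omit [DecidableEq α] in
/-- **Spectator coefficients pull out of the moments**:
`𝓔(∏_{i∈P} aᵢ Xᵢ) = (∏_{i∈P} aᵢ) 𝓔(∏_{i∈P} Xᵢ)`. [folklore] -/
theorem evenMoment_spectator_mul (a : α → evenPart R J)
    (ha : ∀ i, (a i : GrassmannAlgebra R J) ∈ spectatorSubalgebra R (Finset.univ.map e.toEmbedding)) (P : Finset α) :
    evenMoment R e A u (fun i => a i * y i) P = (∏ i ∈ P, a i) * evenMoment R e A u y P := by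
  rw [evenMoment, evenMoment, prod_mul_distrib,
    evenGaussOn_spectator_mul R e A u (coe_prod_mem _ a P fun i _ => ha i)]

end Block

end Literature.MathematicalPhysics.QuantumLattice

/-! ### Scaling covariance of the Ursell function -/

namespace Literature.Probability.LatticeModels

open Finset

variable {α : Type*} [DecidableEq α] {C : Type*} [CommRing C]

/-- The product over the blocks of a set partition of the products over the blocks is the product
over the set. [folklore] -/
theorem prod_prod_eq_prod_of_mem_setPartitions {V : Finset α} {π : Finset (Finset α)} (hπ : π ∈ setPartitions V)
    (a : α → C) : ∏ P ∈ π, ∏ i ∈ P, a i = ∏ i ∈ V, a i := by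
  have hsp := mem_setPartitions.1 hπ
  have h := prod_biUnion (s := π) (t := id) (f := a) hsp.pairwiseDisjoint
  rw [hsp.biUnion_id] at h
  exact h.symm

/-- **Scaling covariance of the Ursell function**: if `m'(P) = (∏_{i∈P} aᵢ) m(P)` for all `P`, then
`ursellOf m' V = (∏_{i∈V} aᵢ) ursellOf m V` for nonempty `V` (multilinearity of the truncated
expectations). [folklore] -/
theorem ursellOf_mul_prod (m : Finset α → C) (a : α → C) {V : Finset α} (hV : V.Nonempty) :
    ursellOf (fun P => (∏ i ∈ P, a i) * m P) V = (∏ i ∈ V, a i) * ursellOf m V := by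
  refine (eq_ursellOf_of_forall (fun P => (∏ i ∈ P, a i) * m P) (fun P => (∏ i ∈ P, a i) * ursellOf m P)
    (fun W hW => ?_) hV).symm
  calc ∑ π ∈ setPartitions W, ∏ P ∈ π, (∏ i ∈ P, a i) * ursellOf m P
      = ∑ π ∈ setPartitions W, (∏ i ∈ W, a i) * ∏ P ∈ π, ursellOf m P := by
        refine sum_congr rfl fun π hπ => ?_
        rw [prod_mul_distrib, prod_prod_eq_prod_of_mem_setPartitions hπ]
    _ = (∏ i ∈ W, a i) * m W := by rw [← mul_sum, sum_setPartitions_prod_ursellOf m hW]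

/-- **Naturality of the Ursell function** under ring homomorphisms: `(φ ∘ m)ᵀ = φ ∘ mᵀ` on nonempty
sets. [folklore] -/
theorem ursellOf_ringHom {D : Type*} [CommRing D] (φ : C →+* D) (m : Finset α → C) {V : Finset α} (hV : V.Nonempty) :
    ursellOf (fun P => φ (m P)) V = φ (ursellOf m V) := by
  refine (eq_ursellOf_of_forall (fun P => φ (m P)) (fun P => φ (ursellOf m P)) (fun W hW => ?_) hV).symm
  simp only [← map_prod, ← map_sum, sum_setPartitions_prod_ursellOf m hW]

end Literature.Probability.LatticeModels

namespace Literature.MathematicalPhysics.QuantumLattice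

open GrassmannAlgebra Finset PowerSeries Literature.Probability.LatticeModels

section Block2

variable (R : Type*) [CommRing R] [Algebra ℚ R] {ι : Type*} [LinearOrder ι] [Fintype ι]
  {J : Type*} [LinearOrder J] [Fintype J]
variable (e : ι ⊕ₗ ι ↪o J) (A : Matrix ι ι R) (u : R) {α : Type*} [DecidableEq α] (y : α → evenPart R J)

/-- **Spectator coefficients pull out of the truncated expectations**:
`𝓔ᵀ(aᵢXᵢ : i ∈ P) = (∏_{i∈P} aᵢ) 𝓔ᵀ(Xᵢ : i ∈ P)` for even spectators `aᵢ` and nonempty `P`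
(Benfatto–Giuliani–Mastropietro 2006, (2.66): the external fields `ψ̃^{(≤h)}(P_v)` factor out of
`𝓔ᵀ_h`). [cite: BenfattoGiulianiMastropietro2006, §2.3 (2.66)] -/
theorem evenTruncated_spectator_mul (a : α → evenPart R J)
    (ha : ∀ i, (a i : GrassmannAlgebra R J) ∈ spectatorSubalgebra R (Finset.univ.map e.toEmbedding))
    {P : Finset α} (hP : P.Nonempty) :
    evenTruncated R e A u (fun i => a i * y i) P = (∏ i ∈ P, a i) * evenTruncated R e A u y P := by
  rw [evenTruncated, evenTruncated, ← ursellOf_mul_prod _ a hP]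
  congr 1
  funext Q
  exact evenMoment_spectator_mul R e A u y a ha Q

/-! ### Families supported in the block: the values are scalars -/

/-- The embedding of the even part of the block's own fermion algebra into the even part of the
whole algebra (transport along `e`). [folklore] -/
def evenMap : evenPart R (ι ⊕ₗ ι) →ₐ[R] evenPart R J :=
  ((ExteriorAlgebra.map (Function.ExtendByZero.linearMap R e)).comp (evenPart R (ι ⊕ₗ ι)).val).codRestrict
    (evenPart R J) fun x => map_mem_evenOdd_zero R _ x.2

omit [Algebra ℚ R] [Fintype ι] [Fintype J] in
/-- Unfolding `evenMap`. [folklore] -/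
@[simp] theorem coe_evenMap (x : evenPart R (ι ⊕ₗ ι)) :
    (evenMap R e x : GrassmannAlgebra R J) = ExteriorAlgebra.map (Function.ExtendByZero.linearMap R e) x := rfl

omit [DecidableEq α] in
/-- **For a family of even elements of the block itself the moments are scalars**:
`𝓔(∏ e_* zᵢ) = (u ∫dψ̄dψ e^{ψ̄Aψ} ∏ zᵢ) · 1`. [folklore] -/
theorem evenMoment_evenMap (z : α → evenPart R (ι ⊕ₗ ι)) (P : Finset α) :
    evenMoment R e A u (fun i => evenMap R e (z i)) P =
      algebraMap R (evenPart R J) (u * berezin R (ι ⊕ₗ ι) (grassmannExp (quadratic R A) * ↑(∏ i ∈ P, z i))) := by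
  refine Subtype.ext ?_
  rw [evenMoment, coe_evenGaussOn, ← map_prod, coe_evenMap, gaussOn_map, Algebra.smul_def, ← map_mul]
  rfl

/-- Hence their truncated expectations are the scalars `mᵀ` of the scalar moments
`m(P) = u ∫dψ̄dψ e^{ψ̄Aψ} ∏_{i∈P} zᵢ` (the block is integrated out completely; cf.
`GrassmannTreeExpansion.lean` for their tree formula). [folklore] -/
theorem evenTruncated_evenMap (z : α → evenPart R (ι ⊕ₗ ι)) {P : Finset α} (hP : P.Nonempty) :
    evenTruncated R e A u (fun i => evenMap R e (z i)) P =
      algebraMap R (evenPart R J) (ursellOf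
        (fun Q => u * berezin R (ι ⊕ₗ ι) (grassmannExp (quadratic R A) * ↑(∏ i ∈ Q, z i))) P) := by
  rw [evenTruncated, ← ursellOf_ringHom (algebraMap R (evenPart R J)) _ hP]
  congr 1
  funext Q
  exact evenMoment_evenMap R e A u z Q

/-! ### The exponential formula with spectators -/

/-- **`𝓔(e^{tX}) = exp Σₙ tⁿ 𝓔ᵀ(X; n)/n!` with spectators**: for an even `X` and the normalised
block integration (`u · ε det A = 1`), the exponential generating function of the moments `𝓔(Xⁿ)`
is the exponential of that of their cumulants `𝓔ᵀ(X; n)`, as formal power series over the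
commutative ring `⋀^{even}` of the remaining fields — the identity defining the effective potential
on the next scale, `𝒱^{(h-1)} + const = Σₙ (1/n!) 𝓔ᵀ_h(𝒱^{(h)}; n)` (Benfatto–Giuliani–Mastropietro
2006, (2.13), (2.29)–(2.31); Mastropietro 2008, (2.36), (2.47)–(2.53)). [cite: BenfattoGiulianiMastropietro2006, §2.3 (2.29)-(2.31)] -/
theorem egf_evenGaussOn_pow_eq_exp_subst (X : evenPart R J)
    (hu : u * ((-1 : R) ^ (Fintype.card ι * (Fintype.card ι - 1) / 2) * A.det) = 1) :
    egf (fun n => evenGaussOn R e A u (X ^ n)) =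
      (exp (evenPart R J)).subst (egfPos (cumulantOf fun n => evenGaussOn R e A u (X ^ n))) :=
  egf_eq_exp_subst_egfPos_cumulantOf _ (by rw [pow_zero, evenGaussOn_one R e A u hu])

/-- The one-variable cumulants are the truncated expectations of copies of `X`:
`cumulantOf (n ↦ 𝓔(Xⁿ)) k = 𝓔ᵀ(X, …, X; Fin k)`. [folklore] -/
theorem cumulantOf_evenGaussOn_pow_eq_evenTruncated (X : evenPart R J) (k : ℕ) :
    cumulantOf (fun n => evenGaussOn R e A u (X ^ n)) k = evenTruncated R e A u (fun _ : Fin k => X) Finset.univ := by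
  rw [cumulantOf, evenTruncated]
  congr 1
  funext P
  rw [evenMoment, prod_const]

end Block2

end Literature.MathematicalPhysics.QuantumLattice
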